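import Mathlib
import HarnessLib
import Literature.Probability.LatticeModels.SRWKilledWalkFunctionals
import Literature.Probability.LatticeModels.GreenBoundaryFactorisation
import Literature.Probability.LatticeModels.MartinRatioBoundaryLimit
import Literature.Probability.LatticeModels.MeshDomainJordan
import Literature.Probability.RandomPlanarGeometry.ConformalRectangle
import Summits.CriticalPhenomena.SAWScalingLimit.Theses.SAWExcursionCardy
import Summits.CriticalPhenomena.SAWScalingLimit.Theorems.SAWExcursionCardyRWGreenCrossRatioLimit

/-!
# Route SAWExcursionCardy — `RWGreenCrossRatioLimit` from the Martin-kernel (ratio) form of the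
# Kozdron–Lawler boundary factorisation

Item `stmt-CriticalPhenomena-4515` (`RWGreenCrossRatioLimit`, support of route `SAWExcursionCardy`): the
random-walk cross-ratio `√Λ_δ`, `Λ_δ = G(a_δ,d_δ) G(c_δ,b_δ) / (G(a_δ,c_δ) G(d_δ,b_δ))`
(`G = SRW.killedGreen (discreteDomainGraph Ω δ)`), tends to Cardy's cross-ratio `crossRatio x` for
every uniformizing datum `(φ, x)` of the conformal rectangle `R = (Ω; a, c, d, b)`.

`SAWExcursionCardyRWGreenCrossRatioLimit.lean` proved the route decl CONDITIONALLY on the named fact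
`KozdronLawler2005_greenBoundaryFactorisationLimit` (`X`): the full two-point factorisation
`G(p,q) / (G(o,p) G(o,q)) → (π/4)(1+s²)(1+t²)/(s−t)²` with its constant. That constant encodes two
inputs the item never uses: the base-point local factors `G(o,·)` (which cancel in the 4-ratio) and
the identification of their normalisation (the two-dimensional potential-kernel asymptotics behind
`π/4`). This file isolates the WEAKER input that the cross-ratio actually consumes:

* `Literature.Probability.LatticeModels.KozdronLawler2005_martinRatioBoundaryLimit` (`X'`, NAMED FACT of
  `Literature/Probability/LatticeModels/MartinRatioBoundaryLimit.lean`, not proved in the tree): the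
  Martin-kernel RATIO form — for an evaluation family `p_δ → u ∈ ∂Ω` and two boundary-vertex pole
  families `q_δ → v`, `e_δ → w` (`u, v, w` distinct boundary points with real preimages `s, t, r` under
  a uniformizer `ψ : ℍ → Ω`, base point `o_δ → ψ(i)`),
  `[G(p,q)/G(o,q)] / [G(p,e)/G(o,e)] → (s−r)²(1+t²) / ((s−t)²(1+r²))`
  (the boundary limit at `s` of the ratio of the two half-plane Martin kernels
  `Im z (1+t²)/|z−t|²` and `Im z (1+r²)/|z−r|²` normalised at `i`). It is the quotient of two
  instances of Kozdron–Lawler 2005, Prop. 3.10, so `X → X'`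
  (`martinRatioBoundaryLimit_of_greenBoundaryFactorisation`, proved here), and its proof needs only
  interior Martin-kernel convergence plus the discrete boundary Harnack principle at ONE boundary
  point — no Green-function constant.
* `tendsto_sqrt_greenCrossRatio_of_martinRatio` — the cross-ratio limit from `X'`: writing
  `Λ = {[G(a,d)/G(o,d)]/[G(a,c)/G(o,c)]} · {[G(b,c)/G(o,c)]/[G(b,d)/G(o,d)]}` (symmetry
  `G(c,b) = G(b,c)`, `G(d,b) = G(b,d)`, `SRW.killedGreen_comm`), the two braces tend to
  `(x₀−x₁)²(1+x₂²)/((x₀−x₂)²(1+x₁²))` and `(x₃−x₂)²(1+x₁²)/((x₃−x₁)²(1+x₂²))`, whose product is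
  `(crossRatio x)²`.
* `RWGreenCrossRatioLimit_of_martinRatioBoundaryLimit` — the route decl, CONDITIONAL on `X'`.

Towards `X'` the tree now has the exit decomposition of `SRW.killedGreen` and the ratio maximum
principle (`Literature/Probability/LatticeModels/SRWKilledGreenExitDecomposition.lean`), the form in
which the discrete boundary Harnack principle (H2 below) is iterated.

## What is deliberately not here

The proof of `X'` (the analytic content of the item): (H1) interior convergence of the lattice
Martin kernel `G(z_δ,q_δ)/G(o_δ,q_δ)` with a boundary-vertex pole to the continuum Martin kernel of the
Jordan domain (Kozdron–Lawler 2005 Prop. 3.10, first display; Chelkak–Smirnov 2011 Thm. 3.13 for a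
flat normalisation point), and (H2) the discrete boundary Harnack principle with ratio convergence at
the lattice scale, uniformly over the local geometry at `u` (Kozdron–Lawler 2005 Prop. 3.10, second
display, via their Lemma 3.11 and the KMT coupling); together with the Carathéodory-kernel convergence
of the lattice domains and the boundary correspondence of the Jordan domain (both available in the
tree: `CaratheodoryKernelPointwise`, `ConformalMapCaratheodoryProofs`).
-/

namespace Summit.CriticalPhenomena.SAWScalingLimit.Theorems

open _root_.Filter _root_.Topology
open scoped _root_.Topology
open _root_.Literature.Probability.LatticeModels _root_.Literature.Probability.RandomPlanarGeometry
open _root_.UpperHalfPlane (upperHalfPlaneSet)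

/-- **The ratio form follows from the full factorisation** (`X → X'`): dividing the two instances
`G(p,q)/(G(o,p)G(o,q)) → (π/4)(1+s²)(1+t²)/(s−t)²` and `G(p,e)/(G(o,p)G(o,e)) → (π/4)(1+s²)(1+r²)/(s−r)²`
of `KozdronLawler2005_greenBoundaryFactorisationLimit`, the local factor `G(o,p)` of the evaluation
point and the constant cancel (the second limit is nonzero, so `G(o,p) ≠ 0` eventually). [folklore] -/
theorem martinRatioBoundaryLimit_of_greenBoundaryFactorisation
    (hKL : Literature.Probability.LatticeModels.KozdronLawler2005_greenBoundaryFactorisationLimit) :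
    Literature.Probability.LatticeModels.KozdronLawler2005_martinRatioBoundaryLimit := by
  intro D ψ s t r u v w hst hsr _htr _huv _huw _hvw _hu _hv _hw hs ht hr p q e o hp hq he ho hmem
  have hmem_pq : ∀ᶠ δ in 𝓝[>] 0, p δ ∈ meshDomain D.carrier δ ∧ q δ ∈ meshDomain D.carrier δ := by
    filter_upwards [hmem] with δ h
    exact ⟨h.1, meshBoundary_subset_meshDomain _ _ h.2.1⟩
  have hmem_pe : ∀ᶠ δ in 𝓝[>] 0, p δ ∈ meshDomain D.carrier δ ∧ e δ ∈ meshDomain D.carrier δ := by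
    filter_upwards [hmem] with δ h
    exact ⟨h.1, meshBoundary_subset_meshDomain _ _ h.2.2.1⟩
  have T1 := hKL D ψ s t u v hst hs ht p q o hp hq ho hmem_pq
  have T2 := hKL D ψ s r u w hsr hs hr p e o hp he ho hmem_pe
  have hL1 : Real.pi / 4 * ((1 + s ^ 2) * (1 + t ^ 2)) / (s - t) ^ 2 ≠ 0 := by
    have : (s - t) ^ 2 ≠ 0 := pow_ne_zero 2 (sub_ne_zero.2 hst)
    positivity
  have hL2 : Real.pi / 4 * ((1 + s ^ 2) * (1 + r ^ 2)) / (s - r) ^ 2 ≠ 0 := by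
    have : (s - r) ^ 2 ≠ 0 := pow_ne_zero 2 (sub_ne_zero.2 hsr)
    positivity
  have hlim : Real.pi / 4 * ((1 + s ^ 2) * (1 + t ^ 2)) / (s - t) ^ 2 /
        (Real.pi / 4 * ((1 + s ^ 2) * (1 + r ^ 2)) / (s - r) ^ 2) =
      (s - r) ^ 2 * (1 + t ^ 2) / ((s - t) ^ 2 * (1 + r ^ 2)) := by
    have e1 : (s - t) ^ 2 ≠ 0 := pow_ne_zero 2 (sub_ne_zero.2 hst)
    have e2 : (s - r) ^ 2 ≠ 0 := pow_ne_zero 2 (sub_ne_zero.2 hsr)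
    have p0 : (1 + s ^ 2) ≠ 0 := by positivity
    have p2 : (1 + r ^ 2) ≠ 0 := by positivity
    have hpi : Real.pi ≠ 0 := Real.pi_ne_zero
    field_simp
  have hmain := T1.div T2 hL2
  rw [hlim] at hmain
  refine hmain.congr' ?_
  filter_upwards [T1.eventually_ne hL1, T2.eventually_ne hL2] with δ h1 h2
  obtain ⟨_, hoq⟩ := div_ne_zero_iff.1 h1
  obtain ⟨_, hoq⟩ := mul_ne_zero_iff.1 hoq
  obtain ⟨_, hoe⟩ := div_ne_zero_iff.1 h2
  obtain ⟨hop, hoe⟩ := mul_ne_zero_iff.1 hoe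
  simp only [Pi.div_apply]
  field_simp

/-- The nearest lattice site to an interior point of a Jordan domain eventually lies in the
discrete domain `meshDomain` (the largest mesh component is the bulk,
`JordanDomain.eventually_forall_mem_meshDomain'`, applied to a closed ball around the point).
[folklore] -/
theorem eventually_nearestSite_mem_meshDomain (D : JordanDomain) {z : ℂ} (hz : z ∈ D.carrier) :
    ∀ᶠ δ in 𝓝[>] (0 : ℝ), nearestSite δ z ∈ meshDomain D.carrier δ := by
  obtain ⟨ρ, hρ, hball⟩ := Metric.isOpen_iff.1 D.isOpen z hz
  have hK : IsCompact (Metric.closedBall z (ρ / 2)) := isCompact_closedBall _ _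
  have hKD : Metric.closedBall z (ρ / 2) ⊆ D.carrier :=
    (Metric.closedBall_subset_ball (by linarith)).trans hball
  filter_upwards [D.eventually_forall_mem_meshDomain' hK hKD, Ioo_mem_nhdsGT (half_pos hρ)]
    with δ hδ hδ'
  refine hδ.1 _ ?_
  rw [Metric.mem_closedBall]
  exact (dist_meshPoint_nearestSite_le hδ'.1 z).trans hδ'.2.le

/-- **The random-walk cross-ratio tends to Cardy's cross-ratio**, conditionally on the Martin-ratio
form `Literature.Probability.LatticeModels.KozdronLawler2005_martinRatioBoundaryLimit` of the Kozdron–Lawler factorisation: with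
`G = SRW.killedGreen (discreteDomainGraph Ω δ)` and `R = (Ω; a, c, d, b)`,
`√(G(a_δ,d_δ) G(c_δ,b_δ) / (G(a_δ,c_δ) G(d_δ,b_δ))) → crossRatio x` for every uniformizing datum
`(φ, x)`. Proof: by symmetry of `G`,
`Λ = {[G(a,d)/G(o,d)]/[G(a,c)/G(o,c)]} · {[G(b,c)/G(o,c)]/[G(b,d)/G(o,d)]}` with base point
`o_δ = nearestSite δ (φ i)` (eventually in `Ω_δ`); the fact at the evaluation point `a` (poles `d, c`)
and at `b` (poles `c, d`) gives the limits `(x₀−x₁)²(1+x₂²)/((x₀−x₂)²(1+x₁²))` and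
`(x₃−x₂)²(1+x₁²)/((x₃−x₁)²(1+x₂²))`, whose product is `(crossRatio x)²`, and `crossRatio x > 0`.
[folklore] -/
theorem tendsto_sqrt_greenCrossRatio_of_martinRatio (hKL : Literature.Probability.LatticeModels.KozdronLawler2005_martinRatioBoundaryLimit)
    (R : ConformalRectangle) (a b c d : ℝ → Site 2)
    (hab : SAW.IsEndpointApprox (R.chord 0 3 (by decide)) a b)
    (hc : Tendsto (fun δ => meshPoint δ (c δ)) (𝓝[>] 0) (𝓝 (R.pt 1)))
    (hd : Tendsto (fun δ => meshPoint δ (d δ)) (𝓝[>] 0) (𝓝 (R.pt 2)))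
    (hbd : ∀ᶠ δ in 𝓝[>] 0, c δ ∈ meshBoundary R.carrier δ ∧ d δ ∈ meshBoundary R.carrier δ)
    (φ : ConformalEquiv upperHalfPlaneSet R.carrier) (x : Fin 4 → ℝ) (hφ : R.IsUniformizing φ x) :
    Tendsto (fun δ => Real.sqrt
      (SRW.killedGreen (discreteDomainGraph R.carrier δ) (a δ) (d δ) *
        SRW.killedGreen (discreteDomainGraph R.carrier δ) (c δ) (b δ) /
        (SRW.killedGreen (discreteDomainGraph R.carrier δ) (a δ) (c δ) *
          SRW.killedGreen (discreteDomainGraph R.carrier δ) (d δ) (b δ))))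
      (𝓝[>] 0) (𝓝 (crossRatio x)) := by
  have hx : Function.Injective x := hφ.injective
  have h01 : x 0 ≠ x 1 := hx.ne (by decide)
  have h02 : x 0 ≠ x 2 := hx.ne (by decide)
  have h12 : x 1 ≠ x 2 := hx.ne (by decide)
  have h13 : x 1 ≠ x 3 := hx.ne (by decide)
  have h23 : x 2 ≠ x 3 := hx.ne (by decide)
  have hP : Function.Injective R.pt := R.pt_injective
  have p01 : R.pt 0 ≠ R.pt 1 := hP.ne (by decide)
  have p02 : R.pt 0 ≠ R.pt 2 := hP.ne (by decide)
  have p03 : R.pt 0 ≠ R.pt 3 := hP.ne (by decide)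
  have p12 : R.pt 1 ≠ R.pt 2 := hP.ne (by decide)
  have p13 : R.pt 1 ≠ R.pt 3 := hP.ne (by decide)
  have p23 : R.pt 2 ≠ R.pt 3 := hP.ne (by decide)
  -- the base point `o_δ → φ i`, eventually a vertex of `Ω_δ`
  have hI : φ Complex.I ∈ R.carrier :=
    φ.mapsTo (show (0 : ℝ) < Complex.I.im by simp)
  set o : ℝ → Site 2 := fun δ => nearestSite δ (φ Complex.I) with ho_def
  have ho : Tendsto (fun δ => meshPoint δ (o δ)) (𝓝[>] 0) (𝓝 (φ Complex.I)) :=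
    tendsto_meshPoint_nearestSite _
  have hoD : ∀ᶠ δ in 𝓝[>] 0, o δ ∈ meshDomain R.carrier δ :=
    eventually_nearestSite_mem_meshDomain R.toJordanDomain hI
  -- the marked points as limits of the lattice families
  have ha : Tendsto (fun δ => meshPoint δ (a δ)) (𝓝[>] 0) (𝓝 (R.pt 0)) := hab.tendsto_fst
  have hb : Tendsto (fun δ => meshPoint δ (b δ)) (𝓝[>] 0) (𝓝 (R.pt 3)) := hab.tendsto_snd
  have hmem_ab : ∀ᶠ δ in 𝓝[>] 0, a δ ∈ meshDomain R.carrier δ ∧ b δ ∈ meshDomain R.carrier δ := by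
    filter_upwards [hab.reachable, eventually_ne_of_tendsto_meshPoint ha hb p03] with δ hr hne
    exact mem_meshDomain_of_reachable_of_ne hr hne
  -- instance 1: evaluation at `a` (`s = x 0`), poles `d` (`t = x 2`) and `c` (`r = x 1`)
  have T1 := hKL R.toJordanDomain φ (x 0) (x 2) (x 1) (R.pt 0) (R.pt 2) (R.pt 1) h02 h01 h12.symm
    p02 p01 p12.symm (R.pt_mem_frontier 0) (R.pt_mem_frontier 2) (R.pt_mem_frontier 1)
    (hφ.2 0) (hφ.2 2) (hφ.2 1) a d c o ha hd hc ho
    (by filter_upwards [hmem_ab, hbd, hoD] with δ h h' h''; exact ⟨h.1, h'.2, h'.1, h''⟩)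
  -- instance 2: evaluation at `b` (`s = x 3`), poles `c` (`t = x 1`) and `d` (`r = x 2`)
  have T2 := hKL R.toJordanDomain φ (x 3) (x 1) (x 2) (R.pt 3) (R.pt 1) (R.pt 2) h13.symm h23.symm
    h12 p13.symm p23.symm p12 (R.pt_mem_frontier 3) (R.pt_mem_frontier 1) (R.pt_mem_frontier 2)
    (hφ.2 3) (hφ.2 1) (hφ.2 2) b c d o hb hc hd ho
    (by filter_upwards [hmem_ab, hbd, hoD] with δ h h' h''; exact ⟨h.2, h'.1, h'.2, h''⟩)
  -- the two limits are nonzero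
  have e01 : x 0 - x 1 ≠ 0 := sub_ne_zero.2 h01
  have e02 : x 0 - x 2 ≠ 0 := sub_ne_zero.2 h02
  have e13 : x 1 - x 3 ≠ 0 := sub_ne_zero.2 h13
  have e23 : x 2 - x 3 ≠ 0 := sub_ne_zero.2 h23
  have e31 : x 3 - x 1 ≠ 0 := sub_ne_zero.2 h13.symm
  have e32 : x 3 - x 2 ≠ 0 := sub_ne_zero.2 h23.symm
  have q0 : (1 + x 0 ^ 2) ≠ 0 := by positivity
  have q1 : (1 + x 1 ^ 2) ≠ 0 := by positivity
  have q2 : (1 + x 2 ^ 2) ≠ 0 := by positivity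
  have q3 : (1 + x 3 ^ 2) ≠ 0 := by positivity
  have hL1 : (x 0 - x 1) ^ 2 * (1 + x 2 ^ 2) / ((x 0 - x 2) ^ 2 * (1 + x 1 ^ 2)) ≠ 0 := by
    have : (x 0 - x 1) ^ 2 ≠ 0 := pow_ne_zero 2 e01
    have : (x 0 - x 2) ^ 2 ≠ 0 := pow_ne_zero 2 e02
    positivity
  have hL2 : (x 3 - x 2) ^ 2 * (1 + x 1 ^ 2) / ((x 3 - x 1) ^ 2 * (1 + x 2 ^ 2)) ≠ 0 := by
    have : (x 3 - x 2) ^ 2 ≠ 0 := pow_ne_zero 2 e32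
    have : (x 3 - x 1) ^ 2 ≠ 0 := pow_ne_zero 2 e31
    positivity
  have hne1 := T1.eventually_ne hL1
  have hne2 := T2.eventually_ne hL2
  -- the 4-ratio is the product of the two Martin ratios (base-point normalisers cancel)
  have heq : ∀ᶠ δ in 𝓝[>] 0,
      Real.sqrt (SRW.killedGreen (discreteDomainGraph R.carrier δ) (a δ) (d δ) /
              SRW.killedGreen (discreteDomainGraph R.carrier δ) (o δ) (d δ) /
            (SRW.killedGreen (discreteDomainGraph R.carrier δ) (a δ) (c δ) /
              SRW.killedGreen (discreteDomainGraph R.carrier δ) (o δ) (c δ)) *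
          (SRW.killedGreen (discreteDomainGraph R.carrier δ) (b δ) (c δ) /
              SRW.killedGreen (discreteDomainGraph R.carrier δ) (o δ) (c δ) /
            (SRW.killedGreen (discreteDomainGraph R.carrier δ) (b δ) (d δ) /
              SRW.killedGreen (discreteDomainGraph R.carrier δ) (o δ) (d δ)))) =
        Real.sqrt (SRW.killedGreen (discreteDomainGraph R.carrier δ) (a δ) (d δ) *
            SRW.killedGreen (discreteDomainGraph R.carrier δ) (c δ) (b δ) /
          (SRW.killedGreen (discreteDomainGraph R.carrier δ) (a δ) (c δ) *
            SRW.killedGreen (discreteDomainGraph R.carrier δ) (d δ) (b δ))) := by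
    filter_upwards [hne1, hne2] with δ h1 h2
    obtain ⟨had, hac⟩ := div_ne_zero_iff.1 h1
    obtain ⟨_, hod⟩ := div_ne_zero_iff.1 had
    obtain ⟨hac, hoc⟩ := div_ne_zero_iff.1 hac
    obtain ⟨_, hbd'⟩ := div_ne_zero_iff.1 h2
    obtain ⟨hbd', _⟩ := div_ne_zero_iff.1 hbd'
    rw [SRW.killedGreen_comm _ (c δ) (b δ), SRW.killedGreen_comm _ (d δ) (b δ)]
    congr 1
    field_simp
  -- the product of the two limits is `(crossRatio x)²`
  have hlim : (x 0 - x 1) ^ 2 * (1 + x 2 ^ 2) / ((x 0 - x 2) ^ 2 * (1 + x 1 ^ 2)) *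
        ((x 3 - x 2) ^ 2 * (1 + x 1 ^ 2) / ((x 3 - x 1) ^ 2 * (1 + x 2 ^ 2))) =
      crossRatio x ^ 2 := by
    unfold crossRatio
    field_simp
    ring
  have hcr : 0 < crossRatio x := (ConformalRectangle.crossRatio_mem_Ioo_of_isUniformizing hφ).1
  have hmain := (T1.mul T2).sqrt
  rw [hlim, Real.sqrt_sq hcr.le] at hmain
  exact hmain.congr' heq

/-- **Item `stmt-CriticalPhenomena-4515` (`RWGreenCrossRatioLimit`), conditional on the Martin-ratio
form.** The route decl `RWGreenCrossRatioLimit` of route `SAWExcursionCardy` holds conditionally on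
`Literature.Probability.LatticeModels.KozdronLawler2005_martinRatioBoundaryLimit` — a strictly weaker input than the full factorisation
`KozdronLawler2005_greenBoundaryFactorisationLimit` used by
`RWGreenCrossRatioLimit_of_greenBoundaryFactorisation` (`martinRatioBoundaryLimit_of_greenBoundaryFactorisation`).
The route's inlined `let Gf` is `SRW.killedGreen` by `SRW.killedGreen_def` (definitional), so this is
`tendsto_sqrt_greenCrossRatio_of_martinRatio` verbatim. [folklore] -/
theorem RWGreenCrossRatioLimit_of_martinRatioBoundaryLimit
    (hKL : Literature.Probability.LatticeModels.KozdronLawler2005_martinRatioBoundaryLimit) :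
    Summit.CriticalPhenomena.SAWScalingLimit.Theses.SAWExcursionCardy.RWGreenCrossRatioLimit := by
  intro R a b c d hab hc hd hbd
  exact tendsto_sqrt_greenCrossRatio_of_martinRatio hKL R a b c d hab hc hd hbd

end Summit.CriticalPhenomena.SAWScalingLimit.Theorems
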